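import Summits.Ventures.PercRepro.RankLevelSetRuleQCellFiveSliceThreeSums
import Summits.Ventures.PercRepro.RankLevelSetRuleQCellSixFalse

/-!
# PercRepro — THE BORDERLINE SLICE `u = 4` OF THE CELL `(q+6, q)`, PART I: THE SLICE SUMS IN CLOSED FORM
(night-1, gen 17; dossier §28)

The module RankLevelSetRuleQCellSixSliceFour proves `Φ(q+6, q) ≤ R̂(q, 6, q−4)` for every `q ≥ 4` — Rule Q's equal split
pays the borderline slice `u = q − #P = 4` of every cell `(q+6, q)` (the slices `u ≤ 3` fail from `q = 264`, p4's
`¬ RhatCell 264 6`; `u = 2` for every `q ≥ 1002`, `not_rhatCell_six`). This part holds the combinatorial half of the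
analytic regime `q ≥ 12` (`q = t + 12`, `m = t + 8`, `x = 4^{t+10}/C(2t+20, t+10)`):
* `sum_range_choose_half_four` — the EVEN half row `2·Σ_{i<m} C(2m+4, i) + C(2m+4, m) + … + C(2m+4, m+4) = 4^{m+2}`
  (row sum + reflection, as `sum_range_choose_half_two`); with the symmetry of the central terms, `sliceFour_row0`;
* `rhat_six_slice_four_ge` — `R̂(m+4, 6, m) ≥ 10S₁ + 45S₂ + 120S₃ + 210S₄ + 252S₅` (every `m̂ ≤ C(q+j+a, a+j)`,
  `mhat_le_choose`; the truncated `j = 5` term is kept);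
* the rows `2t+20 … 2t+24` (`sliceFour_row0 … row4`, by the row step `sum_range_choose_succ_row`) and the ratios between
  the binomials of those rows (`sliceFour_c1, c2, cs0 … cs3, C1 … C4`), the Wallis lower bound `3t + 31 ≤ x²`
  (`sliceFour_wallis`, from `centralBinom_sq_mul_le` at `k = t + 10`);
* **`sliceFour_S1_zero … four`** — the five sums `S₁(t+12+i, t+8)`, `i = 0 … 4`, in closed form `(A_i − B_i·x)/D_i`
  (polynomials in `t` with nonnegative coefficients; `slice_sum_one_eq` through the rows).
Twin: mining/night-1/g17/k6u4_forms.py, k6u4_lean.py (own exact rationals). Axioms: standard.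
-/

namespace PercRepro

open Finset

/-! ### §1 The even half row `2m + 4` -/

/-- **The half row, even case `2m+4`**: `2·Σ_{i<m} C(2m+4, i) + C(2m+4, m) + C(2m+4, m+1) + C(2m+4, m+2) + C(2m+4, m+3)
+ C(2m+4, m+4) = 4^{m+2}` (the row sum `2^{2m+4}`, the terms beyond `m+4` reflected onto the terms below `m`). -/
lemma sum_range_choose_half_four (m : ℕ) :
    2 * ∑ i ∈ range m, (2 * m + 4).choose i + (2 * m + 4).choose m + (2 * m + 4).choose (m + 1)
      + (2 * m + 4).choose (m + 2) + (2 * m + 4).choose (m + 3) + (2 * m + 4).choose (m + 4) = 4 ^ (m + 2) := by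
  have hrow := Nat.sum_range_choose (2 * m + 4)
  rw [show 2 * m + 4 + 1 = (m + 5) + m by ring, Finset.sum_range_add] at hrow
  have hrefl : ∑ i ∈ range m, (2 * m + 4).choose (m + 5 + i) = ∑ i ∈ range m, (2 * m + 4).choose i := by
    rw [← Finset.sum_range_reflect (fun i => (2 * m + 4).choose i) m]
    refine Finset.sum_congr rfl (fun i hi => ?_)
    rw [Finset.mem_range] at hi
    exact Nat.choose_symm_of_eq_add (by omega)
  rw [hrefl, Finset.sum_range_succ, Finset.sum_range_succ, Finset.sum_range_succ, Finset.sum_range_succ,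
    Finset.sum_range_succ] at hrow
  rw [show (4 : ℕ) ^ (m + 2) = 2 ^ (2 * m + 4) by rw [show 2 * m + 4 = 2 * (m + 2) by ring, pow_mul]; norm_num]
  omega

/-! ### §2 The lower bound on `R̂(m+4, 6, m)` -/

/-- **`R̂(m+4, 6, m) ≥ 10S₁ + 45S₂ + 120S₃ + 210S₄ + 252S₅`** on the slice `u = 4` (`q = m + 4`, weights `C(10, j)`):
every `m̂(q, m; a, j) ≤ C(q+j+a, a+j)` (`mhat_le_choose`; at `j = 5` the truncation only drops terms). -/
lemma rhat_six_slice_four_ge (m : ℕ) :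
    10 * ∑ a ∈ range (m + 1), (m.choose a : ℚ) / ((m + 4 + 1 + a).choose (a + 1) : ℚ)
      + 45 * ∑ a ∈ range (m + 1), (m.choose a : ℚ) / ((m + 4 + 2 + a).choose (a + 2) : ℚ)
      + 120 * ∑ a ∈ range (m + 1), (m.choose a : ℚ) / ((m + 4 + 3 + a).choose (a + 3) : ℚ)
      + 210 * ∑ a ∈ range (m + 1), (m.choose a : ℚ) / ((m + 4 + 4 + a).choose (a + 4) : ℚ)
      + 252 * ∑ a ∈ range (m + 1), (m.choose a : ℚ) / ((m + 4 + 5 + a).choose (a + 5) : ℚ)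
      ≤ rhat (m + 4) 6 m := by
  unfold rhat
  rw [sum_Ioo_nat, show (6 : ℕ) - (0 + 1) = 1 + 1 + 1 + 1 + 1 from rfl, Finset.sum_range_succ _ (1 + 1 + 1 + 1),
    Finset.sum_range_succ _ (1 + 1 + 1), Finset.sum_range_succ _ (1 + 1), Finset.sum_range_succ _ 1,
    Finset.sum_range_one]
  simp only [zero_add, add_zero, Nat.reduceAdd, show m + 4 + 6 - m = 10 by omega, Nat.choose_one_right,
    show (10 : ℕ).choose 2 = 45 by decide, show (10 : ℕ).choose 3 = 120 by decide,
    show (10 : ℕ).choose 4 = 210 by decide, show (10 : ℕ).choose 5 = 252 by decide]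
  push_cast
  have key : ∀ (j a : ℕ) (w : ℚ), 0 ≤ w →
      (m.choose a : ℚ) * w / ((m + 4 + j + a).choose (a + j) : ℚ)
        ≤ (m.choose a : ℚ) * w / (mhat (m + 4) m a j : ℚ) := by
    intro j a w hw
    apply div_le_div_of_nonneg_left (by positivity) (by exact_mod_cast mhat_pos _ _ _ _)
    exact_mod_cast mhat_le_choose (m + 4) m a j
  have s1 : 10 * ∑ a ∈ range (m + 1), (m.choose a : ℚ) / ((m + 4 + 1 + a).choose (a + 1) : ℚ)
      ≤ ∑ a ∈ range (m + 1), (m.choose a : ℚ) * 10 / (mhat (m + 4) m a 1 : ℚ) := by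
    rw [Finset.mul_sum]
    refine Finset.sum_le_sum (fun a _ => ?_)
    rw [show (10 : ℚ) * ((m.choose a : ℚ) / ((m + 4 + 1 + a).choose (a + 1) : ℚ))
      = (m.choose a : ℚ) * 10 / ((m + 4 + 1 + a).choose (a + 1) : ℚ) by ring]
    exact key 1 a _ (by positivity)
  have s2 : 45 * ∑ a ∈ range (m + 1), (m.choose a : ℚ) / ((m + 4 + 2 + a).choose (a + 2) : ℚ)
      ≤ ∑ a ∈ range (m + 1), (m.choose a : ℚ) * 45 / (mhat (m + 4) m a 2 : ℚ) := by
    rw [Finset.mul_sum]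
    refine Finset.sum_le_sum (fun a _ => ?_)
    rw [show (45 : ℚ) * ((m.choose a : ℚ) / ((m + 4 + 2 + a).choose (a + 2) : ℚ))
      = (m.choose a : ℚ) * 45 / ((m + 4 + 2 + a).choose (a + 2) : ℚ) by ring]
    exact key 2 a _ (by positivity)
  have s3 : 120 * ∑ a ∈ range (m + 1), (m.choose a : ℚ) / ((m + 4 + 3 + a).choose (a + 3) : ℚ)
      ≤ ∑ a ∈ range (m + 1), (m.choose a : ℚ) * 120 / (mhat (m + 4) m a 3 : ℚ) := by
    rw [Finset.mul_sum]
    refine Finset.sum_le_sum (fun a _ => ?_)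
    rw [show (120 : ℚ) * ((m.choose a : ℚ) / ((m + 4 + 3 + a).choose (a + 3) : ℚ))
      = (m.choose a : ℚ) * 120 / ((m + 4 + 3 + a).choose (a + 3) : ℚ) by ring]
    exact key 3 a _ (by positivity)
  have s4 : 210 * ∑ a ∈ range (m + 1), (m.choose a : ℚ) / ((m + 4 + 4 + a).choose (a + 4) : ℚ)
      ≤ ∑ a ∈ range (m + 1), (m.choose a : ℚ) * 210 / (mhat (m + 4) m a 4 : ℚ) := by
    rw [Finset.mul_sum]
    refine Finset.sum_le_sum (fun a _ => ?_)
    rw [show (210 : ℚ) * ((m.choose a : ℚ) / ((m + 4 + 4 + a).choose (a + 4) : ℚ))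
      = (m.choose a : ℚ) * 210 / ((m + 4 + 4 + a).choose (a + 4) : ℚ) by ring]
    exact key 4 a _ (by positivity)
  have s5 : 252 * ∑ a ∈ range (m + 1), (m.choose a : ℚ) / ((m + 4 + 5 + a).choose (a + 5) : ℚ)
      ≤ ∑ a ∈ range (m + 1), (m.choose a : ℚ) * 252 / (mhat (m + 4) m a 5 : ℚ) := by
    rw [Finset.mul_sum]
    refine Finset.sum_le_sum (fun a _ => ?_)
    rw [show (252 : ℚ) * ((m.choose a : ℚ) / ((m + 4 + 5 + a).choose (a + 5) : ℚ))
      = (m.choose a : ℚ) * 252 / ((m + 4 + 5 + a).choose (a + 5) : ℚ) by ring]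
    exact key 5 a _ (by positivity)
  linarith [s1, s2, s3, s4, s5]

/-! ### §3 The rows `2t+20 … 2t+24` and the ratios, as values (`m = t + 8`) -/

/-- The row `2t+20` (`= 2m+4`): `Σ_{i<t+8} C(2t+20, i) = (4^{t+10} − 2C(2t+20, t+8) − 2C(2t+20, t+9) − C(2t+20, t+10))/2`. -/
lemma sliceFour_row0 (t : ℕ) :
    ∑ i ∈ range (t + 8), ((2 * t + 20).choose i : ℚ)
      = ((4 : ℚ) ^ (t + 10) - 2 * ((2 * t + 20).choose (t + 8) : ℚ) - 2 * ((2 * t + 20).choose (t + 9) : ℚ)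
          - ((2 * t + 20).choose (t + 10) : ℚ)) / 2 := by
  have h := sum_range_choose_half_four (t + 8)
  rw [show 2 * (t + 8) + 4 = 2 * t + 20 by ring, show t + 8 + 1 = t + 9 by ring, show t + 8 + 2 = t + 10 by ring,
    show t + 8 + 3 = t + 11 by ring, show t + 8 + 4 = t + 12 by ring] at h
  have s1 : (2 * t + 20).choose (t + 11) = (2 * t + 20).choose (t + 9) := Nat.choose_symm_of_eq_add (by omega)
  have s2 : (2 * t + 20).choose (t + 12) = (2 * t + 20).choose (t + 8) := Nat.choose_symm_of_eq_add (by omega)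
  rw [s1, s2] at h
  have h' : ((2 * ∑ i ∈ range (t + 8), (2 * t + 20).choose i + (2 * t + 20).choose (t + 8)
      + (2 * t + 20).choose (t + 9) + (2 * t + 20).choose (t + 10) + (2 * t + 20).choose (t + 9)
      + (2 * t + 20).choose (t + 8) : ℕ) : ℚ) = ((4 ^ (t + 10) : ℕ) : ℚ) := by rw [h]
  push_cast at h'
  clear h
  linarith only [h']

/-- The row `2t+21` from the row `2t+20`: `P_1 = 2P_0 − C(2t+20, t+7)`. -/
lemma sliceFour_row1 (t : ℕ) :
    ∑ i ∈ range (t + 8), ((2 * t + 21).choose i : ℚ)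
      = 2 * ∑ i ∈ range (t + 8), ((2 * t + 20).choose i : ℚ) - ((2 * t + 20).choose (t + 7) : ℚ) := by
  have h := sum_range_choose_succ_row (2 * t + 20) (t + 7)
  rw [show 2 * t + 20 + 1 = 2 * t + 21 by ring, show t + 7 + 1 = t + 8 by ring] at h
  exact h

/-- The row `2t+22` from the row `2t+21`: `P_2 = 2P_1 − C(2t+21, t+7)`. -/
lemma sliceFour_row2 (t : ℕ) :
    ∑ i ∈ range (t + 8), ((2 * t + 22).choose i : ℚ)
      = 2 * ∑ i ∈ range (t + 8), ((2 * t + 21).choose i : ℚ) - ((2 * t + 21).choose (t + 7) : ℚ) := by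
  have h := sum_range_choose_succ_row (2 * t + 21) (t + 7)
  rw [show 2 * t + 21 + 1 = 2 * t + 22 by ring, show t + 7 + 1 = t + 8 by ring] at h
  exact h

/-- The row `2t+23` from the row `2t+22`: `P_3 = 2P_2 − C(2t+22, t+7)`. -/
lemma sliceFour_row3 (t : ℕ) :
    ∑ i ∈ range (t + 8), ((2 * t + 23).choose i : ℚ)
      = 2 * ∑ i ∈ range (t + 8), ((2 * t + 22).choose i : ℚ) - ((2 * t + 22).choose (t + 7) : ℚ) := by
  have h := sum_range_choose_succ_row (2 * t + 22) (t + 7)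
  rw [show 2 * t + 22 + 1 = 2 * t + 23 by ring, show t + 7 + 1 = t + 8 by ring] at h
  exact h

/-- The row `2t+24` from the row `2t+23`: `P_4 = 2P_3 − C(2t+23, t+7)`. -/
lemma sliceFour_row4 (t : ℕ) :
    ∑ i ∈ range (t + 8), ((2 * t + 24).choose i : ℚ)
      = 2 * ∑ i ∈ range (t + 8), ((2 * t + 23).choose i : ℚ) - ((2 * t + 23).choose (t + 7) : ℚ) := by
  have h := sum_range_choose_succ_row (2 * t + 23) (t + 7)
  rw [show 2 * t + 23 + 1 = 2 * t + 24 by ring, show t + 7 + 1 = t + 8 by ring] at h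
  exact h

/-- `C(2t+20, t+9) = C(2t+20, t+8)·(t+12)/(t+9)`. -/
lemma sliceFour_c1 (t : ℕ) :
    ((2 * t + 20).choose (t + 9) : ℚ) = ((2 * t + 20).choose (t + 8) : ℚ) * ((t : ℚ) + 12) / ((t : ℚ) + 9) := by
  have h := Nat.choose_succ_right_eq (2 * t + 20) (t + 8)
  rw [show t + 8 + 1 = t + 9 by ring, show 2 * t + 20 - (t + 8) = t + 12 by omega] at h
  have h' : ((2 * t + 20).choose (t + 9) : ℚ) * ((t : ℚ) + 9) = ((2 * t + 20).choose (t + 8) : ℚ) * ((t : ℚ) + 12) := by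
    exact_mod_cast h
  clear h
  rw [eq_div_iff (by positivity)]
  linarith only [h']

/-- `C(2t+20, t+10) = C(2t+20, t+9)·(t+11)/(t+10)`. -/
lemma sliceFour_c2 (t : ℕ) :
    ((2 * t + 20).choose (t + 10) : ℚ) = ((2 * t + 20).choose (t + 9) : ℚ) * ((t : ℚ) + 11) / ((t : ℚ) + 10) := by
  have h := Nat.choose_succ_right_eq (2 * t + 20) (t + 9)
  rw [show t + 9 + 1 = t + 10 by ring, show 2 * t + 20 - (t + 9) = t + 11 by omega] at h
  have h' : ((2 * t + 20).choose (t + 10) : ℚ) * ((t : ℚ) + 10) = ((2 * t + 20).choose (t + 9) : ℚ) * ((t : ℚ) + 11) := by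
    exact_mod_cast h
  clear h
  rw [eq_div_iff (by positivity)]
  linarith only [h']

/-- `C(2t+20, t+7) = C(2t+20, t+8)·(t+8)/(t+13)`. -/
lemma sliceFour_cs0 (t : ℕ) :
    ((2 * t + 20).choose (t + 7) : ℚ) = ((2 * t + 20).choose (t + 8) : ℚ) * ((t : ℚ) + 8) / ((t : ℚ) + 13) := by
  have h := Nat.choose_succ_right_eq (2 * t + 20) (t + 7)
  rw [show t + 7 + 1 = t + 8 by ring, show 2 * t + 20 - (t + 7) = t + 13 by omega] at h
  have h' : ((2 * t + 20).choose (t + 8) : ℚ) * ((t : ℚ) + 8) = ((2 * t + 20).choose (t + 7) : ℚ) * ((t : ℚ) + 13) := by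
    exact_mod_cast h
  clear h
  rw [eq_div_iff (by positivity)]
  linarith only [h']

/-- `C(2t+21, t+7) = C(2t+20, t+7)·(2t+21)/(t+14)`. -/
lemma sliceFour_cs1 (t : ℕ) :
    ((2 * t + 21).choose (t + 7) : ℚ) = ((2 * t + 20).choose (t + 7) : ℚ) * (2 * (t : ℚ) + 21) / ((t : ℚ) + 14) := by
  have h := Nat.choose_mul_succ_eq (2 * t + 20) (t + 7)
  rw [show 2 * t + 20 + 1 = 2 * t + 21 by ring, show 2 * t + 21 - (t + 7) = t + 14 by omega] at h
  have h' : ((2 * t + 20).choose (t + 7) : ℚ) * (2 * (t : ℚ) + 21) = ((2 * t + 21).choose (t + 7) : ℚ) * ((t : ℚ) + 14) := by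
    exact_mod_cast h
  clear h
  rw [eq_div_iff (by positivity)]
  linarith only [h']

/-- `C(2t+22, t+7) = C(2t+21, t+7)·(2t+22)/(t+15)`. -/
lemma sliceFour_cs2 (t : ℕ) :
    ((2 * t + 22).choose (t + 7) : ℚ) = ((2 * t + 21).choose (t + 7) : ℚ) * (2 * (t : ℚ) + 22) / ((t : ℚ) + 15) := by
  have h := Nat.choose_mul_succ_eq (2 * t + 21) (t + 7)
  rw [show 2 * t + 21 + 1 = 2 * t + 22 by ring, show 2 * t + 22 - (t + 7) = t + 15 by omega] at h
  have h' : ((2 * t + 21).choose (t + 7) : ℚ) * (2 * (t : ℚ) + 22) = ((2 * t + 22).choose (t + 7) : ℚ) * ((t : ℚ) + 15) := by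
    exact_mod_cast h
  clear h
  rw [eq_div_iff (by positivity)]
  linarith only [h']

/-- `C(2t+23, t+7) = C(2t+22, t+7)·(2t+23)/(t+16)`. -/
lemma sliceFour_cs3 (t : ℕ) :
    ((2 * t + 23).choose (t + 7) : ℚ) = ((2 * t + 22).choose (t + 7) : ℚ) * (2 * (t : ℚ) + 23) / ((t : ℚ) + 16) := by
  have h := Nat.choose_mul_succ_eq (2 * t + 22) (t + 7)
  rw [show 2 * t + 22 + 1 = 2 * t + 23 by ring, show 2 * t + 23 - (t + 7) = t + 16 by omega] at h
  have h' : ((2 * t + 22).choose (t + 7) : ℚ) * (2 * (t : ℚ) + 23) = ((2 * t + 23).choose (t + 7) : ℚ) * ((t : ℚ) + 16) := by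
    exact_mod_cast h
  clear h
  rw [eq_div_iff (by positivity)]
  linarith only [h']

/-- `C(2t+21, t+8) = C(2t+20, t+8)·(2t+21)/(t+13)`. -/
lemma sliceFour_C1 (t : ℕ) :
    ((2 * t + 21).choose (t + 8) : ℚ) = ((2 * t + 20).choose (t + 8) : ℚ) * (2 * (t : ℚ) + 21) / ((t : ℚ) + 13) := by
  have h := Nat.choose_mul_succ_eq (2 * t + 20) (t + 8)
  rw [show 2 * t + 20 + 1 = 2 * t + 21 by ring, show 2 * t + 21 - (t + 8) = t + 13 by omega] at h
  have h' : ((2 * t + 20).choose (t + 8) : ℚ) * (2 * (t : ℚ) + 21) = ((2 * t + 21).choose (t + 8) : ℚ) * ((t : ℚ) + 13) := by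
    exact_mod_cast h
  clear h
  rw [eq_div_iff (by positivity)]
  linarith only [h']

/-- `C(2t+22, t+8) = C(2t+21, t+8)·(2t+22)/(t+14)`. -/
lemma sliceFour_C2 (t : ℕ) :
    ((2 * t + 22).choose (t + 8) : ℚ) = ((2 * t + 21).choose (t + 8) : ℚ) * (2 * (t : ℚ) + 22) / ((t : ℚ) + 14) := by
  have h := Nat.choose_mul_succ_eq (2 * t + 21) (t + 8)
  rw [show 2 * t + 21 + 1 = 2 * t + 22 by ring, show 2 * t + 22 - (t + 8) = t + 14 by omega] at h
  have h' : ((2 * t + 21).choose (t + 8) : ℚ) * (2 * (t : ℚ) + 22) = ((2 * t + 22).choose (t + 8) : ℚ) * ((t : ℚ) + 14) := by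
    exact_mod_cast h
  clear h
  rw [eq_div_iff (by positivity)]
  linarith only [h']

/-- `C(2t+23, t+8) = C(2t+22, t+8)·(2t+23)/(t+15)`. -/
lemma sliceFour_C3 (t : ℕ) :
    ((2 * t + 23).choose (t + 8) : ℚ) = ((2 * t + 22).choose (t + 8) : ℚ) * (2 * (t : ℚ) + 23) / ((t : ℚ) + 15) := by
  have h := Nat.choose_mul_succ_eq (2 * t + 22) (t + 8)
  rw [show 2 * t + 22 + 1 = 2 * t + 23 by ring, show 2 * t + 23 - (t + 8) = t + 15 by omega] at h
  have h' : ((2 * t + 22).choose (t + 8) : ℚ) * (2 * (t : ℚ) + 23) = ((2 * t + 23).choose (t + 8) : ℚ) * ((t : ℚ) + 15) := by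
    exact_mod_cast h
  clear h
  rw [eq_div_iff (by positivity)]
  linarith only [h']

/-- `C(2t+24, t+8) = C(2t+23, t+8)·(2t+24)/(t+16)`. -/
lemma sliceFour_C4 (t : ℕ) :
    ((2 * t + 24).choose (t + 8) : ℚ) = ((2 * t + 23).choose (t + 8) : ℚ) * (2 * (t : ℚ) + 24) / ((t : ℚ) + 16) := by
  have h := Nat.choose_mul_succ_eq (2 * t + 23) (t + 8)
  rw [show 2 * t + 23 + 1 = 2 * t + 24 by ring, show 2 * t + 24 - (t + 8) = t + 16 by omega] at h
  have h' : ((2 * t + 23).choose (t + 8) : ℚ) * (2 * (t : ℚ) + 24) = ((2 * t + 24).choose (t + 8) : ℚ) * ((t : ℚ) + 16) := by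
    exact_mod_cast h
  clear h
  rw [eq_div_iff (by positivity)]
  linarith only [h']

/-- **Wallis at `k = t+10`**: `3t + 31 ≤ x²` for `x = 4^{t+10}/C(2t+20, t+10)` (`centralBinom_sq_mul_le`). -/
lemma sliceFour_wallis (t : ℕ) :
    3 * (t : ℚ) + 31 ≤ ((4 : ℚ) ^ (t + 10) / ((2 * t + 20).choose (t + 10) : ℚ)) ^ 2 := by
  have h := centralBinom_sq_mul_le (t + 10) (by omega)
  rw [Nat.centralBinom_eq_two_mul_choose, show 2 * (t + 10) = 2 * t + 20 by ring] at h
  have h' : (((2 * t + 20).choose (t + 10) ^ 2 * (3 * (t + 10) + 1) : ℕ) : ℚ) ≤ ((16 ^ (t + 10) : ℕ) : ℚ) := by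
    exact_mod_cast h
  push_cast at h'
  clear h
  have hCb : (0 : ℚ) < ((2 * t + 20).choose (t + 10) : ℚ) := by exact_mod_cast Nat.choose_pos (by omega)
  rw [div_pow, le_div_iff₀ (pow_pos hCb 2)]
  have h16 : (16 : ℚ) ^ (t + 10) = ((4 : ℚ) ^ (t + 10)) ^ 2 := by
    rw [← pow_mul, mul_comm, pow_mul]; norm_num
  rw [← h16]
  linarith only [h']

/-! ### §4 The five `S₁` sums in closed form, `x = 4^{t+10}/C(2t+20, t+10)` -/

/-- `S₁(t+12, t+8)` (the row `2t+20`) in closed form `(A − B·x)/D`. -/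
lemma sliceFour_S1_zero (t : ℕ) :
    ∑ a ∈ range (t + 8 + 1), ((t + 8).choose a : ℚ) / ((t + 8 + 4 + 1 + a).choose (a + 1) : ℚ)
      = (((3276 : ℚ) + (837 : ℚ) * (t : ℚ) + (71 : ℚ) * (t : ℚ) ^ 2 + (2 : ℚ) * (t : ℚ) ^ 3) - ((396 : ℚ) + (69 : ℚ) * (t : ℚ) + (3 : ℚ) * (t : ℚ) ^ 2) * ((4 : ℚ) ^ (t + 10) / ((2 * t + 20).choose (t + 10) : ℚ))) / ((3780 : ℚ) + (1158 : ℚ) * (t : ℚ) + (118 : ℚ) * (t : ℚ) ^ 2 + (4 : ℚ) * (t : ℚ) ^ 3) := by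
  rw [slice_sum_one_eq (t + 8 + 4) (t + 8), show t + 8 + 4 + (t + 8) = 2 * t + 20 by ring]
  push_cast
  have hC : (0 : ℚ) < ((2 * t + 20).choose (t + 8) : ℚ) := by exact_mod_cast Nat.choose_pos (by omega)
  have hC' : ((2 * t + 20).choose (t + 8) : ℚ) ≠ 0 := hC.ne'
  rw [sliceFour_row0, sliceFour_c2, sliceFour_c1]
  field_simp
  ring

/-- `S₁(t+13, t+8)` (the row `2t+21`) in closed form `(A − B·x)/D`. -/
lemma sliceFour_S1_one (t : ℕ) :
    ∑ a ∈ range (t + 8 + 1), ((t + 8).choose a : ℚ) / ((t + 8 + 4 + 1 + 1 + a).choose (a + 1) : ℚ)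
      = (((48594 : ℚ) + (15737 : ℚ) * (t : ℚ) + (1898 : ℚ) * (t : ℚ) ^ 2 + (101 : ℚ) * (t : ℚ) ^ 3 + (2 : ℚ) * (t : ℚ) ^ 4) - ((6864 : ℚ) + (1724 : ℚ) * (t : ℚ) + (144 : ℚ) * (t : ℚ) ^ 2 + (4 : ℚ) * (t : ℚ) ^ 3) * ((4 : ℚ) ^ (t + 10) / ((2 * t + 20).choose (t + 10) : ℚ))) / ((41580 : ℚ) + (16518 : ℚ) * (t : ℚ) + (2456 : ℚ) * (t : ℚ) ^ 2 + (162 : ℚ) * (t : ℚ) ^ 3 + (4 : ℚ) * (t : ℚ) ^ 4) := by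
  rw [slice_sum_one_eq (t + 8 + 4 + 1) (t + 8), show t + 8 + 4 + 1 + (t + 8) = 2 * t + 21 by ring]
  push_cast
  have hC : (0 : ℚ) < ((2 * t + 20).choose (t + 8) : ℚ) := by exact_mod_cast Nat.choose_pos (by omega)
  have hC' : ((2 * t + 20).choose (t + 8) : ℚ) ≠ 0 := hC.ne'
  rw [sliceFour_row1, sliceFour_row0, sliceFour_C1, sliceFour_cs0, sliceFour_c2, sliceFour_c1]
  field_simp
  ring

/-- `S₁(t+14, t+8)` (the row `2t+22`) in closed form `(A − B·x)/D`. -/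
lemma sliceFour_S1_two (t : ℕ) :
    ∑ a ∈ range (t + 8 + 1), ((t + 8).choose a : ℚ) / ((t + 8 + 4 + 1 + 1 + 1 + a).choose (a + 1) : ℚ)
      = (((1555260 : ℚ) + (604072 : ℚ) * (t : ℚ) + (93047 : ℚ) * (t : ℚ) ^ 2 + (7099 : ℚ) * (t : ℚ) ^ 3 + (268 : ℚ) * (t : ℚ) ^ 4 + (4 : ℚ) * (t : ℚ) ^ 5) - ((240240 : ℚ) + (77500 : ℚ) * (t : ℚ) + (9350 : ℚ) * (t : ℚ) ^ 2 + (500 : ℚ) * (t : ℚ) ^ 3 + (10 : ℚ) * (t : ℚ) ^ 4) * ((4 : ℚ) ^ (t + 10) / ((2 * t + 20).choose (t + 10) : ℚ))) / ((956340 : ℚ) + (463074 : ℚ) * (t : ℚ) + (89524 : ℚ) * (t : ℚ) ^ 2 + (8638 : ℚ) * (t : ℚ) ^ 3 + (416 : ℚ) * (t : ℚ) ^ 4 + (8 : ℚ) * (t : ℚ) ^ 5) := by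
  rw [slice_sum_one_eq (t + 8 + 4 + 1 + 1) (t + 8), show t + 8 + 4 + 1 + 1 + (t + 8) = 2 * t + 22 by ring]
  push_cast
  have hC : (0 : ℚ) < ((2 * t + 20).choose (t + 8) : ℚ) := by exact_mod_cast Nat.choose_pos (by omega)
  have hC' : ((2 * t + 20).choose (t + 8) : ℚ) ≠ 0 := hC.ne'
  rw [sliceFour_row2, sliceFour_row1, sliceFour_row0, sliceFour_C2, sliceFour_C1, sliceFour_cs1, sliceFour_cs0, sliceFour_c2, sliceFour_c1]
  field_simp
  ring

/-- `S₁(t+15, t+8)` (the row `2t+23`) in closed form `(A − B·x)/D`. -/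
lemma sliceFour_S1_three (t : ℕ) :
    ∑ a ∈ range (t + 8 + 1), ((t + 8).choose a : ℚ) / ((t + 8 + 4 + 1 + 1 + 1 + 1 + a).choose (a + 1) : ℚ)
      = (((26560170 : ℚ) + (11949363 : ℚ) * (t : ℚ) + (2219139 : ℚ) * (t : ℚ) ^ 2 + (217529 : ℚ) * (t : ℚ) ^ 3 + (11855 : ℚ) * (t : ℚ) ^ 4 + (340 : ℚ) * (t : ℚ) ^ 5 + (4 : ℚ) * (t : ℚ) ^ 6) - ((4324320 : ℚ) + (1683288 : ℚ) * (t : ℚ) + (261300 : ℚ) * (t : ℚ) ^ 2 + (20220 : ℚ) * (t : ℚ) ^ 3 + (780 : ℚ) * (t : ℚ) ^ 4 + (12 : ℚ) * (t : ℚ) ^ 5) * ((4 : ℚ) ^ (t + 10) / ((2 * t + 20).choose (t + 10) : ℚ))) / ((11476080 : ℚ) + (6513228 : ℚ) * (t : ℚ) + (1537362 : ℚ) * (t : ℚ) ^ 2 + (193180 : ℚ) * (t : ℚ) ^ 3 + (13630 : ℚ) * (t : ℚ) ^ 4 + (512 : ℚ) * (t : ℚ) ^ 5 + (8 : ℚ)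 * (t : ℚ) ^ 6) := by
  rw [slice_sum_one_eq (t + 8 + 4 + 1 + 1 + 1) (t + 8), show t + 8 + 4 + 1 + 1 + 1 + (t + 8) = 2 * t + 23 by ring]
  push_cast
  have hC : (0 : ℚ) < ((2 * t + 20).choose (t + 8) : ℚ) := by exact_mod_cast Nat.choose_pos (by omega)
  have hC' : ((2 * t + 20).choose (t + 8) : ℚ) ≠ 0 := hC.ne'
  rw [sliceFour_row3, sliceFour_row2, sliceFour_row1, sliceFour_row0, sliceFour_C3, sliceFour_C2, sliceFour_C1, sliceFour_cs2, sliceFour_cs1, sliceFour_cs0, sliceFour_c2, sliceFour_c1]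
  field_simp
  ring

/-- `S₁(t+16, t+8)` (the row `2t+24`) in closed form `(A − B·x)/D`. -/
lemma sliceFour_S1_four (t : ℕ) :
    ∑ a ∈ range (t + 8 + 1), ((t + 8).choose a : ℚ) / ((t + 8 + 4 + 1 + 1 + 1 + 1 + 1 + a).choose (a + 1) : ℚ)
      = (((960976800 : ℚ) + (488801994 : ℚ) * (t : ℚ) + (105544533 : ℚ) * (t : ℚ) ^ 2 + (12527700 : ℚ) * (t : ℚ) ^ 3 + (881611 : ℚ) * (t : ℚ) ^ 4 + (36718 : ℚ) * (t : ℚ) ^ 5 + (836 : ℚ) * (t : ℚ) ^ 6 + (8 : ℚ) * (t : ℚ) ^ 7) - ((161441280 : ℚ) + (72932832 : ℚ) * (t : ℚ) + (13682872 : ℚ) * (t : ℚ) ^ 2 + (1364580 : ℚ) * (t : ℚ) ^ 3 + (76300 : ℚ) * (t : ℚ) ^ 4 + (2268 : ℚ) * (t : ℚ) ^ 5 + (28 : ℚ) * (t : ℚ) ^ 6) * ((4 : ℚ) ^ (t + 10) / ((2 * t + 20).choose (t + 10) : ℚ))) / ((286902000 : ℚ) + (185782860 : ℚ) * (t : ℚ)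 + (51460506 : ℚ) * (t : ℚ) ^ 2 + (7904224 : ℚ) * (t : ℚ) ^ 3 + (727110 : ℚ) * (t : ℚ) ^ 4 + (40060 : ℚ) * (t : ℚ) ^ 5 + (1224 : ℚ) * (t : ℚ) ^ 6 + (16 : ℚ) * (t : ℚ) ^ 7) := by
  rw [slice_sum_one_eq (t + 8 + 4 + 1 + 1 + 1 + 1) (t + 8), show t + 8 + 4 + 1 + 1 + 1 + 1 + (t + 8) = 2 * t + 24 by ring]
  push_cast
  have hC : (0 : ℚ) < ((2 * t + 20).choose (t + 8) : ℚ) := by exact_mod_cast Nat.choose_pos (by omega)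
  have hC' : ((2 * t + 20).choose (t + 8) : ℚ) ≠ 0 := hC.ne'
  rw [sliceFour_row4, sliceFour_row3, sliceFour_row2, sliceFour_row1, sliceFour_row0, sliceFour_C4, sliceFour_C3, sliceFour_C2, sliceFour_C1, sliceFour_cs3, sliceFour_cs2, sliceFour_cs1, sliceFour_cs0, sliceFour_c2, sliceFour_c1]
  field_simp
  ring

end PercRepro
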